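import Summits.HodgeConjecture.HodgeConjecture.Theses.BoundaryReadout
import Summits.HodgeConjecture.HodgeConjecture.Theses.QbarEnvelope
import Summits.HodgeConjecture.HodgeConjecture.Theorems.EndoscopicMiddleDegreeCupProductAlgebraicOfChernCharacter
import Literature.AlgebraicGeometry.HodgeTheory.HolomorphicBundleChernCharacterSplit
import Literature.AlgebraicGeometry.HodgeTheory.ComplexConjugationHolds
import HarnessLib

/-!
# Birth skeleton (BC3) for the crux `PullbackAlgebraic` of route `BoundaryReadout`
# (item `stmt-HodgeConjecture-1071`, shared with route `QbarEnvelope`) — line `birth`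

Crux (verbatim the route decl): for every `ℂ`-morphism `ι : X ⟶ W` of smooth projective complex
varieties and every `p`, `ι^*(algebraicClasses W p) ⊆ algebraicClasses X p`, i.e.
`ι^*(Nᵖ H²ᵖ(W(ℂ); ℂ)) ⊆ Nᵖ H²ᵖ(X(ℂ); ℂ)` on the tree's coniveau carrier (Fulton 1998, Cor. 19.2 (b);
Voisin II, Prop. 9.21 (i)). A general `ι` is neither flat nor dominant, so the support of a cycle can
collapse in codimension under `ι⁻¹`; the printed proofs move the cycle (Chow's moving lemma) or use
refined Gysin maps (deformation to the normal cone), neither of which the tree has.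

## The line: Grothendieck's K-theoretic road (Deligne, Clay §2 (ii); Voisin I, Thm. 11.32)

Chern characters of vector bundles pull back to Chern characters of the pulled-back bundles along ANY
morphism (`ch ∘ ι^* = ι^* ∘ ch`, Fulton §15.1 (ii); Kobayashi Ch. II §1 Axiom 2), with no
transversality condition. Hence the crux follows from the two halves of "cycle classes and Chern
characters of (holomorphic = algebraic, GAGA) vector bundles span the same subspace of `H²ᵖ`" used on
the two DIFFERENT varieties:

* `stub_algebraicClasses_le_spanChernCharacter` — on the SOURCE OF THE CLASS `W`: every algebraic
  class is a `ℂ`-combination of `p`-th Chern characters of holomorphic vector bundles (resolve `𝒪_Z`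
  by vector bundles, `ch[𝒪_Z] = [Z] +` higher-codimension terms, induction on codimension: Deligne
  (ii), Fulton Ex. 15.2.16 (b), Kobayashi Thm. II.1.17). Verbatim (`Iff.rfl`) the named fact
  `Literature.AlgebraicGeometry.HodgeTheory.algebraicClasses_le_span_holomorphicBundleChernCharacter`
  (inclusion `⊇` of Voisin I Thm. 11.32 ⊗ ℂ; unproved in the tree).
* `stub_spanChernCharacter_le_algebraicClasses` — on the TARGET `X`: Chern characters of holomorphic
  vector bundles on a smooth PROJECTIVE variety are algebraic classes (twist by an ample `H`, pull back
  Schubert cycles from a Grassmannian, untwist: Voisin I pp. 282–283, Prop. 11.35; or GAGA + Fulton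
  Prop. 19.1.2). Verbatim (`Iff.rfl`) the named fact
  `Literature.AlgebraicGeometry.HodgeTheory.span_holomorphicBundleChernCharacter_le_algebraicClasses`
  (inclusion `⊆`; unproved in the tree; projectivity essential — Kähler barrier
  `Voisin2002_weilTorus_hodgeClassWithoutSubvarieties`).
* `PullbackAlgebraic_of` — the kernel-checked composition: Hodge models exist
  (`nonempty_hodgeModel_holds`, PROVED), `c' ∈ span ch_p` on `W` by the first stub, `ι^* c' ∈ span ch_p`
  on `X` by the PROVED naturality of Chern–Weil classes through induced Hodge models
  (`map_mem_span_holomorphicBundleChernCharacter_induce` / `_of_induce`, both dimension orders,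
  `Theorems/EndoscopicMiddleDegreeCupProductAlgebraicOfChernCharacter`), algebraic by the second stub
  applied to THAT Hodge model of `X` (both stubs quantify over all Hodge models).

Neither stub alone gives the crux (one speaks about spanning on the source, the other about
algebraicity on the target), neither is the crux or the summit reworded, and both are theorems in
print with partial cases proved in the tree (`HolomorphicBundleChernCharacter{Proofs,TopDegree,
Hyperplane,ProjectiveSpace}`: degrees `p = 0`, `p ≥ dim`, `ℙⁿ`, hyperplane classes). Closing both also
closes `CupProductAlgebraic` of route `EndoscopicMiddleDegree` (tree:
`cupProductAlgebraic_of_span_chernCharacter`), which is equivalent to this crux in the tree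
(`Theorems/EndoscopicMiddleDegreeAlgebraicOrEnvelopedStubPullbackAlgebraic.stub_pullbackAlgebraic` and
`cupProduct_mem_algebraicClasses_of_forall_map_diagonal`).

Shared item: the crux is ONE item wanted by `QbarEnvelope` (primary decl
`QbarEnvelope.PullbackAlgebraic`) and `BoundaryReadout`; both decls are concluded below
(`PullbackAlgebraic_proof`, `PullbackAlgebraic_of_stubs`), the statements being syntactically identical.

Disproof used: none relevant (no `Disproof.lean` / Negative lemmas exist for this crux; the negatives
index of the summit — MilnorKExponential symbol lift, Fermat sextic multisets, E-line lattice matrices —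
does not touch Chern characters or the coniveau carrier).
-/

noncomputable section

-- `Summit.HodgeConjecture.HodgeConjecture.…` is the mandated namespace (single-conjunct summit).
set_option linter.dupNamespace false

namespace Summit.HodgeConjecture.HodgeConjecture.Cruxes.PullbackAlgebraic.Birth

open CategoryTheory
open Literature.AlgebraicGeometry Literature.AlgebraicGeometry.HodgeTheory
open Summit.HodgeConjecture.HodgeConjecture.Theorems.EndoscopicMiddleDegree

/-- **Stub 1 (source side; Deligne, Clay §2 (ii) / Fulton Ex. 15.2.16 (b); inclusion `⊇` of
Voisin I Thm. 11.32 ⊗ ℂ).** On a smooth projective complex variety, every algebraic class of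
codimension `p` (element of `Nᵖ H²ᵖ(X(ℂ); ℂ)`) is a `ℂ`-linear combination of `p`-th Chern characters
of holomorphic vector bundles on `X^an`, in every Hodge model `A`. Size: L (locally free resolutions
on smooth projective varieties, `ch[𝒪_Z] = [Z] + …`, Chern–Weil representatives through the comparison
of `A`). Verbatim the tree's named fact `algebraicClasses_le_span_holomorphicBundleChernCharacter`. -/
theorem stub_algebraicClasses_le_spanChernCharacter :
    ∀ ⦃n : ℕ⦄ ⦃X : Motives.SchemeOver ℂ⦄, Motives.IsSmoothProjective n X →
      ∀ (A : HodgeModel n X) (p : ℕ),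
        algebraicClasses X p ≤ Submodule.span ℂ (A.holomorphicBundleChernCharacter p) := by
  sorry

/-- **Stub 2 (target side; Voisin I Thm. 11.32, inclusion `⊆`, pp. 282–283 with Prop. 11.35;
GAGA, Serre n° 20 Prop. 18; Fulton Prop. 19.1.2).** On a smooth PROJECTIVE complex variety, the
`ℂ`-span of the `p`-th Chern characters of holomorphic vector bundles is contained in the algebraic
classes `Nᵖ H²ᵖ(X(ℂ); ℂ)`, in every Hodge model `A`. Size: L (ample twist to global generation,
classifying map to a Grassmannian whose cohomology is algebraic, Whitney/twisting formula to untwist).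
Verbatim the tree's named fact `span_holomorphicBundleChernCharacter_le_algebraicClasses`. -/
theorem stub_spanChernCharacter_le_algebraicClasses :
    ∀ ⦃n : ℕ⦄ ⦃X : Motives.SchemeOver ℂ⦄, Motives.IsSmoothProjective n X →
      ∀ (A : HodgeModel n X) (p : ℕ),
        Submodule.span ℂ (A.holomorphicBundleChernCharacter p) ≤ algebraicClasses X p := by
  sorry

/-- By-name linkage (kernel-checked, `Iff.rfl`): stub 1 is the named fact
`algebraicClasses_le_span_holomorphicBundleChernCharacter`. -/
example :
    (∀ ⦃n : ℕ⦄ ⦃X : Motives.SchemeOver ℂ⦄, Motives.IsSmoothProjective n X →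
      ∀ (A : HodgeModel n X) (p : ℕ),
        algebraicClasses X p ≤ Submodule.span ℂ (A.holomorphicBundleChernCharacter p)) ↔
      algebraicClasses_le_span_holomorphicBundleChernCharacter :=
  Iff.rfl

/-- By-name linkage (kernel-checked, `Iff.rfl`): stub 2 is the named fact
`span_holomorphicBundleChernCharacter_le_algebraicClasses`. -/
example :
    (∀ ⦃n : ℕ⦄ ⦃X : Motives.SchemeOver ℂ⦄, Motives.IsSmoothProjective n X →
      ∀ (A : HodgeModel n X) (p : ℕ),
        Submodule.span ℂ (A.holomorphicBundleChernCharacter p) ≤ algebraicClasses X p) ↔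
      span_holomorphicBundleChernCharacter_le_algebraicClasses :=
  Iff.rfl

/-- **Composition (real proof, no `sorry`): the two stubs imply the crux `PullbackAlgebraic` BY NAME.**
Given `ι : X ⟶ W` (smooth projective, `dim X = n`, `dim W = m`) and `c' ∈ algebraicClasses W p`: pick
Hodge models `A` of `W` and `B` of `X` (`nonempty_hodgeModel_holds`). If `n ≤ m`, stub 1 on `(W, A)`
puts `c'` in `span ch_p`, naturality (`map_mem_span_holomorphicBundleChernCharacter_induce`) puts
`ι^* c'` in the `span ch_p` of the induced model `B.induce A _` of `X`, and stub 2 on that model makes it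
algebraic. If `m < n`, stub 1 is applied on the induced model `A.induce B _` of `W`, naturality
(`map_mem_span_holomorphicBundleChernCharacter_of_induce`) lands in the `span ch_p` of `B`, and stub 2
on `(X, B)` concludes. -/
theorem PullbackAlgebraic_of :
    (∀ ⦃n : ℕ⦄ ⦃X : Motives.SchemeOver ℂ⦄, Motives.IsSmoothProjective n X →
      ∀ (A : HodgeModel n X) (p : ℕ),
        algebraicClasses X p ≤ Submodule.span ℂ (A.holomorphicBundleChernCharacter p)) →
    (∀ ⦃n : ℕ⦄ ⦃X : Motives.SchemeOver ℂ⦄, Motives.IsSmoothProjective n X →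
      ∀ (A : HodgeModel n X) (p : ℕ),
        Submodule.span ℂ (A.holomorphicBundleChernCharacter p) ≤ algebraicClasses X p) →
    Summit.HodgeConjecture.HodgeConjecture.Theses.BoundaryReadout.PullbackAlgebraic := by
  intro hspan halg n X hX m W hW ι p c' hc'
  -- Hodge models of the source of the class `W` and of the target `X` (proved existence fact)
  obtain ⟨A⟩ := (nonempty_hodgeModel_holds (n := m) (X := W)).nonempty hW
  obtain ⟨B⟩ := (nonempty_hodgeModel_holds (n := n) (X := X)).nonempty hX
  rcases le_or_gt n m with hnm | hmn
  · -- `dim X ≤ dim W`: comparison induced on the `n`-manifold side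
    have h₁ : c' ∈ Submodule.span ℂ (A.holomorphicBundleChernCharacter p) := hspan hW A p hc'
    have h₂ := map_mem_span_holomorphicBundleChernCharacter_induce A B hnm hX hW ι h₁
    exact halg hX (B.induce A hnm) p h₂
  · -- `dim W < dim X`: stub 1 on the induced model of `W`, stub 2 on `B`
    have h₁ : c' ∈ Submodule.span ℂ ((A.induce B hmn.le).holomorphicBundleChernCharacter p) :=
      hspan hW (A.induce B hmn.le) p hc'
    have h₂ := map_mem_span_holomorphicBundleChernCharacter_of_induce A B hmn.le hX hW ι h₁
    exact halg hX B p h₂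

/-- **The crux, closed modulo exactly the two registered stubs** (the conventional instantiated form:
its only non-whitelisted axiom is the `sorryAx` of `stub_algebraicClasses_le_spanChernCharacter` and
`stub_spanChernCharacter_le_algebraicClasses`; no `sorry` occurs outside the two stubs). -/
theorem PullbackAlgebraic_of_stubs :
    Summit.HodgeConjecture.HodgeConjecture.Theses.BoundaryReadout.PullbackAlgebraic :=
  PullbackAlgebraic_of stub_algebraicClasses_le_spanChernCharacter
    stub_spanChernCharacter_le_algebraicClasses

/-! ### The shared item's primary decl (`QbarEnvelope.PullbackAlgebraic`, stmt-HodgeConjecture-1071)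

The item is SHARED by routes `QbarEnvelope` (where it was first filed) and `BoundaryReadout`; the two
route files carry syntactically identical `def PullbackAlgebraic`, so the composition above proves the
`QbarEnvelope` decl by definitional unfolding. `ledger skeleton check` keys on the item's primary decl. -/

/-- **Composition for the primary decl (sorry-free):** the two stubs imply
`QbarEnvelope.PullbackAlgebraic` (definitionally the same statement as `BoundaryReadout.PullbackAlgebraic`). -/
theorem PullbackAlgebraic_of_qbarEnvelope :
    (∀ ⦃n : ℕ⦄ ⦃X : Motives.SchemeOver ℂ⦄, Motives.IsSmoothProjective n X →
      ∀ (A : HodgeModel n X) (p : ℕ),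
        algebraicClasses X p ≤ Submodule.span ℂ (A.holomorphicBundleChernCharacter p)) →
    (∀ ⦃n : ℕ⦄ ⦃X : Motives.SchemeOver ℂ⦄, Motives.IsSmoothProjective n X →
      ∀ (A : HodgeModel n X) (p : ℕ),
        Submodule.span ℂ (A.holomorphicBundleChernCharacter p) ≤ algebraicClasses X p) →
    Summit.HodgeConjecture.HodgeConjecture.Theses.QbarEnvelope.PullbackAlgebraic :=
  fun hspan halg => PullbackAlgebraic_of hspan halg

/-- **THE SKELETON THEOREM (primary decl).** The crux item stmt-HodgeConjecture-1071, as the decl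
`Summit.HodgeConjecture.HodgeConjecture.Theses.QbarEnvelope.PullbackAlgebraic`, closed modulo exactly the
two registered stubs (axioms: their `sorryAx` only; no `sorry` outside `stub_*`). -/
theorem PullbackAlgebraic_proof :
    Summit.HodgeConjecture.HodgeConjecture.Theses.QbarEnvelope.PullbackAlgebraic :=
  PullbackAlgebraic_of_qbarEnvelope stub_algebraicClasses_le_spanChernCharacter
    stub_spanChernCharacter_le_algebraicClasses

end Summit.HodgeConjecture.HodgeConjecture.Cruxes.PullbackAlgebraic.Birth

end
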